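import Literature.IUT.LogThetaLattice.GlobalKummerNonInterferenceRemark3101ModelAdic
import HarnessLib

/-!
# [IUTchIII] Remark 3.10.1 (i)/(ii) — the `MOD`/`𝔪𝔬𝔡` contrast with the `𝔪𝔬𝔡` side assembled over ALL finite places
# (proof-only sequel of `…Remark3101Model.lean` / `…Remark3101ModelAdic.lean`)

S. Mochizuki, *Inter-universal Teichmüller theory III*, kurims manuscript (May 2020), Remark 3.10.1 (i)/(ii),
pp. 149–150 (pinned by the proof of Cor. 3.12 at Steps (ix)/(x), p. 180); Example 3.6 (ii), p. 107: an object
of `𝓕⊛_𝔪𝔬𝔡` is "a collection of 'fractional ideals' `𝔍_v ⊆ K_v` for each `v ∈ 𝕍`" [claim: Mochizuki2012, status: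
disputed — nothing of the series is asserted here].

The two earlier files of this seat (abc-iut-w4-d002 gen 2; p432249, p432866) prove the typed contrast
`Remark3101ii_contrast` with the `𝔪𝔬𝔡` side = ONE local portion `(F_v, 𝒪_v)`. THIS FILE (proof-only, no `def`,
no new `Prop`) assembles the `𝔪𝔬𝔡` side GLOBALLY, matching the granularity of the `MOD` side (whose objects
`FrakObj (ModelPlaces F)` are families over all places): a Frobenius-like `𝔪𝔬𝔡`-datum is a FAMILY of local
regions `E_w ⊆ F_w = w.adicCompletion F` over ALL finite places `w` of the number field `F = F_mod`, together
with an arbitrary further component `a : A` (archimedean portions, global data — anything, acted on by an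
arbitrary map `Ψ`); the log-link acts componentwise through the local logarithms,
`(E, a) ↦ ((w ↦ Φ_w (log_w (E_w ∩ 𝒪_w^×))), Ψ a)` — every family of additive `logk_w` on `𝒪_w^×` (in particular
THE `p_w`-adic logarithms) and every family of post-processings `Φ_w`.

* `frakFamily_logImage_not_injective` — this global log-link-induced map is NOT injective: two families that
  differ only at one finite place `v`, by `𝒪_v` versus `F_v`, have the same image (the local theorem
  `logImage_coe_eq_logImage_univ`, p432249, at `v`; identical elsewhere) — "one-sided inclusions, as opposed
  to precise equalities", now for the assembled object;
* `remark3101i_noCompatibleIso_frakFamily` — hence Rmk. 3.10.1 (i)'s "one cannot construct log-link-compatible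
  isomorphisms of Frobenioids for `(†𝓕⊛_𝔪𝔬𝔡)_α`" holds for the GLOBAL `𝔪𝔬𝔡` column and every coric object;
* **`remark3101ii_contrast_frakFamily`** — the `MOD`/`𝔪𝔬𝔡` CONTRAST of Rmk. 3.10.1 (ii) with BOTH sides global
  over the same number field `F`: `MOD` = the Kummer column `κ_m : K_m ⥲ F` of model global Frobenioids
  (`prop310iii_model`, p413222), `𝔪𝔬𝔡` = families of local regions over all finite places (+ any further
  component); `remark3101ii_contrast_frakFamily_frak_witness` — non-vacuity of the `𝔪𝔬𝔡` conjunct through the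
  genuine coric identification `Equiv.refl`.

HONEST SCOPE. The one modelling step is unchanged and stated: the log-link acts on local Frobenius-like data
only through `log : 𝒪^× → F_v` ([IUTchIII] Def. 1.1 (i)), so on regions it induces maps of the shape
`E ↦ Φ (log (E ∩ 𝒪^×))`; the archimedean/other components are carried by an ARBITRARY `Ψ`, so nothing is
assumed about them. Not done: the Frobenioid structure of [FrdI] Def. 1.3 on `𝓕⊛_𝔪𝔬𝔡` and its realification.
No side taken on [IUTchIII] Cor. 3.12; nothing here says abc is proved or refuted; typed ≠ proved elsewhere.
-/

noncomputable section

namespace Literature.IUT.LogThetaLattice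

open IsDedekindDomain NumberField GlobalFrobenioidModels

variable (F : Type) [Field F] [NumberField F]

/-- `𝒪_v ≠ F_v` for a finite place `v`: the inverse of the image of a nonzero element of `𝔭_v` is not
`v`-integral; private helper (as in the local sequel). [folklore] -/
private theorem coe_adicCompletionIntegers_ne_univ (v : HeightOneSpectrum (𝓞 F)) :
    ((v.adicCompletionIntegers F : Set (v.adicCompletion F))) ≠ Set.univ := by
  obtain ⟨π, hπ, hπ0⟩ := Submodule.exists_mem_ne_zero_of_ne_bot v.ne_bot
  have hlt : v.valuation F (algebraMap (𝓞 F) F π) < 1 := by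
    rw [HeightOneSpectrum.valuation_of_algebraMap]
    exact (HeightOneSpectrum.intValuation_lt_one_iff_mem v π).mpr hπ
  have hne : v.valuation F (algebraMap (𝓞 F) F π) ≠ 0 := by
    rw [HeightOneSpectrum.valuation_of_algebraMap]
    exact v.intValuation_ne_zero π hπ0
  intro h
  have hmem : ((algebraMap (𝓞 F) F π : F) : v.adicCompletion F)⁻¹ ∈
      (v.adicCompletionIntegers F : Set (v.adicCompletion F)) := h ▸ Set.mem_univ _
  rw [SetLike.mem_coe, HeightOneSpectrum.mem_adicCompletionIntegers, map_inv₀,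
    HeightOneSpectrum.valuedAdicCompletion_eq_valuation', inv_le_one₀ (zero_lt_iff.mpr hne)] at hmem
  exact (not_le.mpr hlt) hmem

variable {A : Type}

/-- **The GLOBAL log-link-induced map on `𝔪𝔬𝔡`-side data is NOT INJECTIVE**: on families of local regions over
all finite places (plus an arbitrary further component acted on by an arbitrary `Ψ`), the componentwise map
`(E, a) ↦ ((w ↦ Φ_w (log_w (E_w ∩ 𝒪_w^×))), Ψ a)` identifies the two families that differ only at `v` by
`𝒪_v` versus `F_v`. ([IUTchIII] Rmk 3.10.1 (i) p.149–150; Ex 3.6 (ii) p.107) [claim: Mochizuki2012, status: disputed] -/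
theorem frakFamily_logImage_not_injective (v : HeightOneSpectrum (𝓞 F))
    (logk : ∀ w : HeightOneSpectrum (𝓞 F), Additive (↥(w.adicCompletionIntegers F))ˣ →+ w.adicCompletion F)
    (Φ : ∀ w : HeightOneSpectrum (𝓞 F), Set (w.adicCompletion F) → Set (w.adicCompletion F))
    (Ψ : A → A) (a : A) :
    ¬ Function.Injective (fun Ea : (∀ w : HeightOneSpectrum (𝓞 F), Set (w.adicCompletion F)) × A =>
      ((fun w => Φ w ((fun x : (↥(w.adicCompletionIntegers F))ˣ => logk w (Additive.ofMul x)) ''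
          {x : (↥(w.adicCompletionIntegers F))ˣ |
            ((x : ↥(w.adicCompletionIntegers F)) : w.adicCompletion F) ∈ Ea.1 w})),
        Ψ Ea.2)) := by
  classical
  intro hinj
  let E₂ : ∀ w : HeightOneSpectrum (𝓞 F), Set (w.adicCompletion F) := fun _ => Set.univ
  let E₁ : ∀ w : HeightOneSpectrum (𝓞 F), Set (w.adicCompletion F) :=
    Function.update E₂ v (v.adicCompletionIntegers F : Set (v.adicCompletion F))
  have himg : (fun Ea : (∀ w : HeightOneSpectrum (𝓞 F), Set (w.adicCompletion F)) × A =>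
      ((fun w => Φ w ((fun x : (↥(w.adicCompletionIntegers F))ˣ => logk w (Additive.ofMul x)) ''
          {x : (↥(w.adicCompletionIntegers F))ˣ |
            ((x : ↥(w.adicCompletionIntegers F)) : w.adicCompletion F) ∈ Ea.1 w})),
        Ψ Ea.2)) (E₁, a) =
      (fun Ea : (∀ w : HeightOneSpectrum (𝓞 F), Set (w.adicCompletion F)) × A =>
      ((fun w => Φ w ((fun x : (↥(w.adicCompletionIntegers F))ˣ => logk w (Additive.ofMul x)) ''
          {x : (↥(w.adicCompletionIntegers F))ˣ |
            ((x : ↥(w.adicCompletionIntegers F)) : w.adicCompletion F) ∈ Ea.1 w})),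
        Ψ Ea.2)) (E₂, a) := by
    refine Prod.ext (funext fun w => ?_) rfl
    by_cases hw : w = v
    · subst hw
      simp only [E₁, E₂, Function.update_self]
      rw [logImage_coe_eq_logImage_univ]
    · simp only [E₁, E₂, Function.update_of_ne hw]
  have hE : E₁ = E₂ := congrArg Prod.fst (hinj himg)
  have hv : E₁ v = E₂ v := congrFun hE v
  simp only [E₁, E₂, Function.update_self] at hv
  exact coe_adicCompletionIntegers_ne_univ F v hv

/-- … hence NOT a bijection. ([IUTchIII] Rmk 3.10.1 (i) p.149–150) [claim: Mochizuki2012, status: disputed] -/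
theorem frakFamily_logImage_not_bijective (v : HeightOneSpectrum (𝓞 F))
    (logk : ∀ w : HeightOneSpectrum (𝓞 F), Additive (↥(w.adicCompletionIntegers F))ˣ →+ w.adicCompletion F)
    (Φ : ∀ w : HeightOneSpectrum (𝓞 F), Set (w.adicCompletion F) → Set (w.adicCompletion F))
    (Ψ : A → A) (a : A) :
    ¬ Function.Bijective (fun Ea : (∀ w : HeightOneSpectrum (𝓞 F), Set (w.adicCompletion F)) × A =>
      ((fun w => Φ w ((fun x : (↥(w.adicCompletionIntegers F))ˣ => logk w (Additive.ofMul x)) ''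
          {x : (↥(w.adicCompletionIntegers F))ˣ |
            ((x : ↥(w.adicCompletionIntegers F)) : w.adicCompletion F) ∈ Ea.1 w})),
        Ψ Ea.2)) :=
  fun h => frakFamily_logImage_not_injective F v logk Φ Ψ a h.1

/-- **[IUTchIII] Rmk. 3.10.1 (i) for the GLOBAL `𝔪𝔬𝔡` column**: the column of `𝔪𝔬𝔡`-data (families of local
regions over all finite places of `F` + an arbitrary further component) under the componentwise
log-link-induced map admits NO log-link-compatible family of identifications with ANY coric object `C` — "one
cannot construct log-link-compatible isomorphisms of Frobenioids for '`(†𝓕⊛_𝔪𝔬𝔡)_α`'".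
([IUTchIII] Rmk 3.10.1 (i) p.149–150) [claim: Mochizuki2012, status: disputed] -/
theorem remark3101i_noCompatibleIso_frakFamily (v : HeightOneSpectrum (𝓞 F))
    (logk : ∀ w : HeightOneSpectrum (𝓞 F), Additive (↥(w.adicCompletionIntegers F))ˣ →+ w.adicCompletion F)
    (Φ : ∀ w : HeightOneSpectrum (𝓞 F), Set (w.adicCompletion F) → Set (w.adicCompletion F))
    (Ψ : A → A) (a : A) (C : Type) :
    Literature.IUT.LogThetaLattice.Remark3101i_noCompatibleIso (C := C)
      (fun _ : ℤ => (∀ w : HeightOneSpectrum (𝓞 F), Set (w.adicCompletion F)) × A)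
      (fun (_ : ℤ) (Ea : (∀ w : HeightOneSpectrum (𝓞 F), Set (w.adicCompletion F)) × A) =>
        ((fun w => Φ w ((fun x : (↥(w.adicCompletionIntegers F))ˣ => logk w (Additive.ofMul x)) ''
            {x : (↥(w.adicCompletionIntegers F))ˣ |
              ((x : ↥(w.adicCompletionIntegers F)) : w.adicCompletion F) ∈ Ea.1 w})),
          Ψ Ea.2)) :=
  Remark3101i_noCompatibleIso_of_not_bijective
    (F := fun _ : ℤ => (∀ w : HeightOneSpectrum (𝓞 F), Set (w.adicCompletion F)) × A)
    (lg := fun (_ : ℤ) (Ea : (∀ w : HeightOneSpectrum (𝓞 F), Set (w.adicCompletion F)) × A) =>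
        ((fun w => Φ w ((fun x : (↥(w.adicCompletionIntegers F))ˣ => logk w (Additive.ofMul x)) ''
            {x : (↥(w.adicCompletionIntegers F))ˣ |
              ((x : ↥(w.adicCompletionIntegers F)) : w.adicCompletion F) ∈ Ea.1 w})),
          Ψ Ea.2))
    (m := 0) (frakFamily_logImage_not_bijective F v logk Φ Ψ a) C

/-- **[IUTchIII] Rmk. 3.10.1 (ii) — THE `MOD`/`𝔪𝔬𝔡` CONTRAST, BOTH SIDES GLOBAL over the number field `F = F_mod`.**
`MOD`: any Kummer column `κ_m : K_m ⥲ F` (Prop. 3.10 (i)) of model global Frobenioids with the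
log-link-induced transports — a log-link-compatible Kummer family EXISTS (`prop310iii_model`, "precise
log-Kummer correspondence"); `𝔪𝔬𝔡`: families of local regions over all finite places (+ any further component
under any `Ψ`) with the componentwise log-link-induced map, every family of additive `logk_w` (in particular
THE `p_w`-adic logarithms) and of post-processings `Φ_w` — NO compatible family with the coric container's
data exists ("upper semi-compatible … one-sided inclusions"). ([IUTchIII] Rmk 3.10.1 (ii) p.150; Cor 3.12
proof Steps (ix)/(x) p.180) [claim: Mochizuki2012, status: disputed] -/
theorem remark3101ii_contrast_frakFamily (v : HeightOneSpectrum (𝓞 F)) {Kf : ℤ → Type} [∀ m, Field (Kf m)] (κ : ∀ m, Kf m ≃+* F)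
    (logk : ∀ w : HeightOneSpectrum (𝓞 F), Additive (↥(w.adicCompletionIntegers F))ˣ →+ w.adicCompletion F)
    (Φ : ∀ w : HeightOneSpectrum (𝓞 F), Set (w.adicCompletion F) → Set (w.adicCompletion F))
    (Ψ : A → A) (a : A) :
    Literature.IUT.LogThetaLattice.Remark3101ii_contrast (FrakObj (ModelPlaces F) (fun _ => ℝ))
      ((∀ w : HeightOneSpectrum (𝓞 F), Set (w.adicCompletion F)) × A)
      (fun m => FrakObj (ModelPlaces (Kf m)) (fun _ => ℝ))
      (fun _ => (∀ w : HeightOneSpectrum (𝓞 F), Set (w.adicCompletion F)) × A)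
      (fun m => ⇑(frakTransport ((κ m).trans (κ (m + 1)).symm)))
      (fun (_ : ℤ) (Ea : (∀ w : HeightOneSpectrum (𝓞 F), Set (w.adicCompletion F)) × A) =>
        ((fun w => Φ w ((fun x : (↥(w.adicCompletionIntegers F))ˣ => logk w (Additive.ofMul x)) ''
            {x : (↥(w.adicCompletionIntegers F))ˣ |
              ((x : ↥(w.adicCompletionIntegers F)) : w.adicCompletion F) ∈ Ea.1 w})),
          Ψ Ea.2)) :=
  Remark3101ii_contrast_of (CMOD := FrakObj (ModelPlaces F) (fun _ => ℝ))
    (Cfrak := (∀ w : HeightOneSpectrum (𝓞 F), Set (w.adicCompletion F)) × A)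
    (FMOD := fun m => FrakObj (ModelPlaces (Kf m)) (fun _ => ℝ))
    (Ffrak := fun _ => (∀ w : HeightOneSpectrum (𝓞 F), Set (w.adicCompletion F)) × A)
    (fun m => ⇑(frakTransport ((κ m).trans (κ (m + 1)).symm)))
    (fun (_ : ℤ) (Ea : (∀ w : HeightOneSpectrum (𝓞 F), Set (w.adicCompletion F)) × A) =>
      ((fun w => Φ w ((fun x : (↥(w.adicCompletionIntegers F))ˣ => logk w (Additive.ofMul x)) ''
          {x : (↥(w.adicCompletionIntegers F))ˣ |
            ((x : ↥(w.adicCompletionIntegers F)) : w.adicCompletion F) ∈ Ea.1 w})),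
        Ψ Ea.2))
    (fun m => (frakTransport ((κ m).trans (κ (m + 1)).symm)).bijective) (frakTransport (κ 0))
    (m := 0) (frakFamily_logImage_not_bijective F v logk Φ Ψ a)

/-- Non-vacuity of the `𝔪𝔬𝔡` conjunct of the global contrast: through the genuine coric identification
`Equiv.refl` it yields a NON-BIJECTIVE global `𝔪𝔬𝔡`-side log-link map (abc-iut-L6-d3's
`.exists_not_bijective_frak`). ([IUTchIII] Rmk 3.10.1 (i)(ii) p.149–150) [claim: Mochizuki2012, status: disputed] -/
theorem remark3101ii_contrast_frakFamily_frak_witness (v : HeightOneSpectrum (𝓞 F)) {Kf : ℤ → Type} [∀ m, Field (Kf m)]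
    (κ : ∀ m, Kf m ≃+* F)
    (logk : ∀ w : HeightOneSpectrum (𝓞 F), Additive (↥(w.adicCompletionIntegers F))ˣ →+ w.adicCompletion F)
    (Φ : ∀ w : HeightOneSpectrum (𝓞 F), Set (w.adicCompletion F) → Set (w.adicCompletion F))
    (Ψ : A → A) (a : A) :
    ∃ m : ℤ, ¬ Function.Bijective
      ((fun (_ : ℤ) (Ea : (∀ w : HeightOneSpectrum (𝓞 F), Set (w.adicCompletion F)) × A) =>
        ((fun w => Φ w ((fun x : (↥(w.adicCompletionIntegers F))ˣ => logk w (Additive.ofMul x)) ''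
            {x : (↥(w.adicCompletionIntegers F))ˣ |
              ((x : ↥(w.adicCompletionIntegers F)) : w.adicCompletion F) ∈ Ea.1 w})),
          Ψ Ea.2)) m) :=
  (remark3101ii_contrast_frakFamily F v κ logk Φ Ψ a).exists_not_bijective_frak (Equiv.refl _)

end Literature.IUT.LogThetaLattice

end
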